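import Summits.RiemannHypothesis.RiemannHypothesis.Theorems.SuzukiKernelThetaDeriv
import Literature.Analysis.SpecialFunctions.DigammaLogBound

/-!
# The digamma part of the `θ`-flow generator through Gauss's series (column DBR; RH-FREE)

RH-FREE throughout; nothing here bears on the truth of RH.

Third piece of the decomposition `J_θ = k ∗ K_θ` behind `FlowPairing` (`Theorems.SuzukiThetaFlowDefs`): in
`L(z) = −2ξ'/ξ(s)`, `s = ½ − iz`, the archimedean part is `log π − ψ(s/2)`, and on the line `Im z = 1`
(`s = 3/2 − iu`, `w = s/2`, `Re w = 3/4`) Gauss's series (Andrews–Askey–Roy (1.2.13); tree: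
`Literature.Analysis.SpecialFunctions.Complex.hasSum_one_div_sub_one_div_digamma`) gives
`ψ(s/2) = −γ + Σ_{k≥0} [1/(k+1) − 2/(s+2k)]`.  Multiplying by the symbol `Θ_θ` and inverting along the line TERM BY
TERM (absolute convergence: `|1/(k+1) − 2/(s+2k)| = |s−2|/((k+1)|s+2k|) ≤ (k+1)⁻¹ ((1+|u|)/(2k+3/2))^ε`, against the
symbol decay `(1+|u|)^{−θ}`, `ε = min(1, (θ−1)/2)`):

* **`invFourierLine_digamma_mul_limTheta`** — for `θ > 1` and real `x`:
  `invFourierLine (z ↦ ψ((½−iz)/2) Θ_θ(z)) 1 x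
     = −γ · invFourierLine Θ_θ 1 x + Σ' k, [ invFourierLine Θ_θ 1 x /(k+1) − 2 · invFourierLine (z ↦ Θ_θ(z)/((½−iz) + 2k)) 1 x ]`.

Each `invFourierLine (z ↦ Θ_θ(z)/(s + 2k)) 1 x` is `∫ 𝟙_{v>0} e^{−(2k+½)v} K_θ(x−v) dv` by
`Theorems.SuzukiFlowKernelPolarPart.invFourierLine_inv_sub_mul_limTheta` (`a = −2k − ½`), so the digamma part of
`J_θ` is `−γK_θ + Σ_k [K_θ/(k+1) − 2 e_{−(2k+½)} ∗ K_θ]` — the `x`-side of Bombieri's archimedean term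
(`weilArchTermBombieri`: kernel `e^{t/2}/sinh t = Σ_k 2e^{−(2k+½)t}`).

References: [Su20] M. Suzuki, ASPM 84 (2020) = arXiv:1907.07302, (1.9); G. E. Andrews, R. Askey, R. Roy, *Special
Functions* (1999), Thm 1.2.5 (1.2.13); E. Bombieri, Rend. Lincei (9) 11 (2000), Thm 2.
-/

noncomputable section

-- D-0017: `Summit.<S>.<S>.…` is the designed namespace of a single-problem summit.
set_option linter.dupNamespace false

open Complex MeasureTheory Filter Topology Set Metric

namespace Summit.RiemannHypothesis.RiemannHypothesis.Theorems.SuzukiKernelSemigroup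

open Literature.NumberTheory.LFunctions

/-! ## §1 An elementary `rpow` bound -/

/-- RH-FREE.  If `0 ≤ X ≤ 1`, `X ≤ y` and `0 < ε ≤ 1` then `X ≤ y^ε` (`min(1, y) ≤ y^ε`). -/
theorem le_rpow_of_le_one_of_le {X y ε : ℝ} (hX0 : 0 ≤ X) (hX1 : X ≤ 1) (hXy : X ≤ y) (hε0 : 0 < ε)
    (hε1 : ε ≤ 1) : X ≤ y ^ ε := by
  have hy0 : 0 ≤ y := hX0.trans hXy
  rcases le_or_gt y 1 with hy1 | hy1
  · exact hXy.trans (Real.self_le_rpow_of_le_one hy0 hy1 hε1)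
  · exact hX1.trans (Real.one_le_rpow hy1.le hε0.le)

/-! ## §2 The Gauss coefficients on the line `Im z = 1` -/

/-- RH-FREE.  On `Im z = 1`: `s = ½ − i(u+i) = 3/2 − iu`, so `s + 2k` has real part `2k + 3/2 > 0` and is non-zero. -/
theorem half_sub_line_add_ne_zero (u : ℝ) (k : ℕ) :
    (1 : ℂ) / 2 - I * ((u : ℂ) + ((1 : ℝ) : ℂ) * I) + 2 * (k : ℂ) ≠ 0 := by
  intro h
  have := congrArg Complex.re h
  rw [half_sub_I_mul_line_one] at this
  simp at this
  linarith [(Nat.cast_nonneg k : (0 : ℝ) ≤ k)]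

/-- RH-FREE.  The `k`-th Gauss coefficient: `1/(k+1) − 2/(s+2k) = (s − 2)/((k+1)(s+2k))`. -/
theorem gaussCoeff_eq (s : ℂ) (k : ℕ) (hs : s + 2 * (k : ℂ) ≠ 0) :
    1 / ((k : ℂ) + 1) - 2 / (s + 2 * (k : ℂ)) = (s - 2) / (((k : ℂ) + 1) * (s + 2 * (k : ℂ))) := by
  have hk : (k : ℂ) + 1 ≠ 0 := by
    have : (0 : ℝ) < (k : ℝ) + 1 := by positivity
    exact_mod_cast this.ne'
  rw [div_sub_div _ _ hk hs]
  congr 1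
  ring

/-- RH-FREE.  Norm bound for the Gauss coefficients on `Im z = 1`: with `s = 3/2 − iu` and `0 < ε ≤ 1`,
`‖1/(k+1) − 2/(s+2k)‖ ≤ (k+1)⁻¹ · ((1 + |u|)/(2k + 3/2))^ε`. -/
theorem norm_gaussCoeff_line_le (u : ℝ) (k : ℕ) {ε : ℝ} (hε0 : 0 < ε) (hε1 : ε ≤ 1) :
    ‖1 / ((k : ℂ) + 1) - 2 / ((1 : ℂ) / 2 - I * ((u : ℂ) + ((1 : ℝ) : ℂ) * I) + 2 * (k : ℂ))‖ ≤
      1 / ((k : ℝ) + 1) * ((1 + |u|) / (2 * (k : ℝ) + 3 / 2)) ^ ε := by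
  set s : ℂ := (1 : ℂ) / 2 - I * ((u : ℂ) + ((1 : ℝ) : ℂ) * I) with hs
  have hs' : s = (((3 / 2 : ℝ)) : ℂ) + ((-u : ℝ) : ℂ) * I := by rw [hs, half_sub_I_mul_line_one]
  have hne := half_sub_line_add_ne_zero u k
  rw [← hs] at hne
  rw [gaussCoeff_eq s k hne, norm_div, norm_mul]
  have hk0 : (0 : ℝ) < (k : ℝ) + 1 := by positivity
  have hk1 : ‖(k : ℂ) + 1‖ = (k : ℝ) + 1 := by
    have : (k : ℂ) + 1 = (((k : ℝ) + 1 : ℝ) : ℂ) := by push_cast; ring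
    rw [this, Complex.norm_real, Real.norm_eq_abs, abs_of_pos hk0]
  -- the two norms
  have hA : 0 < 2 * (k : ℝ) + 3 / 2 := by positivity
  have hnum : ‖s - 2‖ ≤ 1 + |u| := by
    have e : s - 2 = (((-(1 / 2) : ℝ)) : ℂ) + ((-u : ℝ) : ℂ) * I := by rw [hs']; push_cast; ring
    rw [e]
    refine (norm_add_le _ _).trans ?_
    rw [Complex.norm_real, norm_mul, Complex.norm_real, Complex.norm_I, mul_one, Real.norm_eq_abs,
      Real.norm_eq_abs, abs_neg, abs_neg]
    norm_num
  have hden_re : 2 * (k : ℝ) + 3 / 2 ≤ ‖s + 2 * (k : ℂ)‖ := by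
    have h1 := Complex.abs_re_le_norm (s + 2 * (k : ℂ))
    have h2 : (s + 2 * (k : ℂ)).re = 2 * (k : ℝ) + 3 / 2 := by rw [hs']; simp; ring
    rw [h2, abs_of_pos hA] at h1
    exact h1
  have hden_num : ‖s - 2‖ ≤ ‖s + 2 * (k : ℂ)‖ := by
    have h1 : ‖s - 2‖ ^ 2 ≤ ‖s + 2 * (k : ℂ)‖ ^ 2 := by
      rw [Complex.sq_norm, Complex.sq_norm, Complex.normSq_apply, Complex.normSq_apply, hs']
      simp
      nlinarith [(Nat.cast_nonneg k : (0 : ℝ) ≤ k)]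
    exact (pow_le_pow_iff_left₀ (norm_nonneg _) (norm_nonneg _) two_ne_zero).1 h1
  have hden0 : 0 < ‖s + 2 * (k : ℂ)‖ := lt_of_lt_of_le hA hden_re
  -- `X := ‖s−2‖/‖s+2k‖ ≤ 1` and `≤ (1+|u|)/(2k+3/2)`
  set X : ℝ := ‖s - 2‖ / ‖s + 2 * (k : ℂ)‖ with hX
  have hX0 : 0 ≤ X := div_nonneg (norm_nonneg _) hden0.le
  have hX1 : X ≤ 1 := (div_le_one hden0).2 hden_num
  have hXy : X ≤ (1 + |u|) / (2 * (k : ℝ) + 3 / 2) := by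
    rw [hX]
    calc ‖s - 2‖ / ‖s + 2 * (k : ℂ)‖ ≤ (1 + |u|) / ‖s + 2 * (k : ℂ)‖ :=
          div_le_div_of_nonneg_right hnum hden0.le
      _ ≤ (1 + |u|) / (2 * (k : ℝ) + 3 / 2) :=
          div_le_div_of_nonneg_left (by positivity) hA hden_re
  have hXε := le_rpow_of_le_one_of_le hX0 hX1 hXy hε0 hε1
  rw [hk1]
  calc ‖s - 2‖ / (((k : ℝ) + 1) * ‖s + 2 * (k : ℂ)‖)
      = 1 / ((k : ℝ) + 1) * X := by rw [hX]; field_simp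
    _ ≤ 1 / ((k : ℝ) + 1) * ((1 + |u|) / (2 * (k : ℝ) + 3 / 2)) ^ ε :=
        mul_le_mul_of_nonneg_left hXε (by positivity)

/-! ## §3 Gauss's series on the line and the integrability of the digamma integrand -/

/-- RH-FREE.  Gauss's series for `ψ(s/2)` on `Im z = 1` (`s = ½ − i(u+i)`, `Re(s/2) = 3/4`):
`ψ(s/2) = −γ + Σ' k, (1/(k+1) − 2/(s+2k))`. -/
theorem digamma_half_line_eq_tsum (u : ℝ) :
    digamma (((1 : ℂ) / 2 - I * ((u : ℂ) + ((1 : ℝ) : ℂ) * I)) / 2) =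
      -(Real.eulerMascheroniConstant : ℂ) +
        ∑' k : ℕ, (1 / ((k : ℂ) + 1) - 2 / ((1 : ℂ) / 2 - I * ((u : ℂ) + ((1 : ℝ) : ℂ) * I) + 2 * (k : ℂ))) := by
  set s : ℂ := (1 : ℂ) / 2 - I * ((u : ℂ) + ((1 : ℝ) : ℂ) * I) with hs
  have hw : 0 < (s / 2).re := by
    rw [hs, Complex.div_ofNat_re, half_sub_I_mul_line_one]; simp
  have h := Literature.Analysis.SpecialFunctions.Complex.hasSum_one_div_sub_one_div_digamma hw
  have hterm : ∀ k : ℕ, 1 / ((k : ℂ) + 1) - 1 / (s / 2 + (k : ℂ)) = 1 / ((k : ℂ) + 1) - 2 / (s + 2 * (k : ℂ)) := by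
    intro k
    have hne : s + 2 * (k : ℂ) ≠ 0 := by rw [hs]; exact half_sub_line_add_ne_zero u k
    have hne2 : s / 2 + (k : ℂ) ≠ 0 := by
      intro h0; apply hne; linear_combination 2 * h0
    congr 1
    rw [show s / 2 + (k : ℂ) = (s + 2 * (k : ℂ)) / 2 by ring, one_div_div]
  simp_rw [hterm] at h
  rw [h.tsum_eq]
  ring

/-- RH-FREE.  The digamma factor is continuous along `Im z = 1`. -/
theorem continuous_digamma_half_line :
    Continuous fun u : ℝ => digamma (((1 : ℂ) / 2 - I * ((u : ℂ) + ((1 : ℝ) : ℂ) * I)) / 2) := by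
  refine Literature.Analysis.SpecialFunctions.Complex.continuousOn_digamma.comp_continuous (by fun_prop) fun u => ?_
  show 0 < ((((1 : ℂ) / 2 - I * ((u : ℂ) + ((1 : ℝ) : ℂ) * I)) / 2)).re
  rw [Complex.div_ofNat_re, half_sub_I_mul_line_one]; simp

/-- RH-FREE.  Logarithmic growth of the digamma factor along `Im z = 1`: there is `C ≥ 0` with
`‖ψ(s/2)‖ ≤ C + log(1 + |u|)` (`s/2 = 3/4 − iu/2`; the tree's `exists_norm_digamma_vertical_le`). -/
theorem norm_digamma_half_line_le :
    ∃ C : ℝ, 0 ≤ C ∧ ∀ u : ℝ, ‖digamma (((1 : ℂ) / 2 - I * ((u : ℂ) + ((1 : ℝ) : ℂ) * I)) / 2)‖ ≤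
      C + Real.log (1 + |u|) := by
  obtain ⟨C, hC⟩ := Literature.Analysis.SpecialFunctions.Complex.exists_norm_digamma_vertical_le
    (a := 3 / 4) (by norm_num)
  refine ⟨max C 0, le_max_right _ _, fun u => ?_⟩
  have e : ((1 : ℂ) / 2 - I * ((u : ℂ) + ((1 : ℝ) : ℂ) * I)) / 2 = ((3 / 4 : ℝ) : ℂ) + ((-u / 2 : ℝ) : ℂ) * I := by
    rw [half_sub_I_mul_line_one]; push_cast; ring
  rw [e]
  refine (hC (-u / 2)).trans ?_
  have hlog : Real.log (1 + |(-u / 2)|) ≤ Real.log (1 + |u|) := by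
    apply Real.log_le_log (by positivity)
    rw [abs_div, abs_neg, abs_two]
    linarith [abs_nonneg u]
  linarith [le_max_left C 0]

/-- RH-FREE.  The digamma integrand `ψ(s/2) Θ_θ(u+i) e^{−i(u+i)x}` is integrable along `Im z = 1` (`θ > 1`). -/
theorem integrable_digamma_mul_limTheta_lineIntegrand {θ : ℝ} (hθ : 1 < θ) (x : ℝ) :
    Integrable fun u : ℝ => digamma (((1 : ℂ) / 2 - I * ((u : ℂ) + ((1 : ℝ) : ℂ) * I)) / 2) *
      limTheta θ ((u : ℂ) + ((1 : ℝ) : ℂ) * I) * Complex.exp (-I * ((u : ℂ) + ((1 : ℝ) : ℂ) * I) * (x : ℂ)) := by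
  obtain ⟨C, hC0, hC⟩ := norm_digamma_half_line_le
  obtain ⟨C₁, hC₁0, hC₁⟩ := norm_limTheta_line_le (θ := θ) (by linarith) (b₀ := 1) (by norm_num)
  set r : ℝ := θ - (θ - 1) / 2 with hr
  have hr1 : 1 < r := by rw [hr]; linarith
  have hmeas : AEStronglyMeasurable (fun u : ℝ => digamma (((1 : ℂ) / 2 - I * ((u : ℂ) + ((1 : ℝ) : ℂ) * I)) / 2) *
      limTheta θ ((u : ℂ) + ((1 : ℝ) : ℂ) * I) * Complex.exp (-I * ((u : ℂ) + ((1 : ℝ) : ℂ) * I) * (x : ℂ))) volume :=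
    ((continuous_digamma_half_line.mul (continuous_limTheta_line θ (b := 1) (by norm_num))).mul
      (by fun_prop)).aestronglyMeasurable
  refine Integrable.mono' ((((integrable_one_add_abs_rpow_neg' hr1).const_mul
    ((C + 1 / ((θ - 1) / 2)) * C₁)).mul_const (Real.exp x))) hmeas (Eventually.of_forall fun u => ?_)
  rw [norm_mul, norm_mul, norm_cexp_line_one]
  have hy0 : 0 < 1 + |u| := by linarith [abs_nonneg u]
  have h1 := hC u
  have h2 := hC₁ 1 le_rfl u
  have hlog := log_mul_rpow_le hC0 hθ u
  have hlog0 : 0 ≤ Real.log (1 + |u|) := Real.log_nonneg (by linarith [abs_nonneg u])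
  calc ‖digamma (((1 : ℂ) / 2 - I * ((u : ℂ) + ((1 : ℝ) : ℂ) * I)) / 2)‖ *
        ‖limTheta θ ((u : ℂ) + ((1 : ℝ) : ℂ) * I)‖ * Real.exp x
      ≤ (C + Real.log (1 + |u|)) * (C₁ * (1 + |u|) ^ (-θ)) * Real.exp x := by gcongr
    _ = ((C + Real.log (1 + |u|)) * (1 + |u|) ^ (-θ)) * C₁ * Real.exp x := by ring
    _ ≤ ((C + 1 / ((θ - 1) / 2)) * (1 + |u|) ^ (-(θ - (θ - 1) / 2))) * C₁ * Real.exp x := by gcongr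
    _ = (C + 1 / ((θ - 1) / 2)) * C₁ * (1 + |u|) ^ (-r) * Real.exp x := by rw [hr]; ring

/-! ## §4 Term-by-term inversion -/

/-- **RH-FREE · the digamma part of the `θ`-flow generator, term by term**: for `θ > 1` and real `x`,
`invFourierLine (z ↦ ψ((½−iz)/2)·Θ_θ(z)) 1 x
   = −γ·invFourierLine Θ_θ 1 x + Σ' k, [invFourierLine Θ_θ 1 x/(k+1) − 2·invFourierLine (z ↦ Θ_θ(z)/((½−iz)+2k)) 1 x]`,
the series converging absolutely. -/
theorem invFourierLine_digamma_mul_limTheta {θ : ℝ} (hθ : 1 < θ) (x : ℝ) :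
    invFourierLine (fun z : ℂ => digamma ((1 / 2 - I * z) / 2) * limTheta θ z) 1 x =
      -(Real.eulerMascheroniConstant : ℂ) * invFourierLine (limTheta θ) 1 x +
        ∑' k : ℕ, (1 / ((k : ℂ) + 1) * invFourierLine (limTheta θ) 1 x -
          2 * invFourierLine (fun z : ℂ => limTheta θ z / ((1 / 2 - I * z) + 2 * (k : ℂ))) 1 x) := by
  -- notation along the line
  set Θ : ℝ → ℂ := fun u => limTheta θ ((u : ℂ) + ((1 : ℝ) : ℂ) * I) with hΘ
  set E : ℝ → ℂ := fun u => Complex.exp (-I * ((u : ℂ) + ((1 : ℝ) : ℂ) * I) * (x : ℂ)) with hE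
  set sL : ℝ → ℂ := fun u => (1 : ℂ) / 2 - I * ((u : ℂ) + ((1 : ℝ) : ℂ) * I) with hsL
  set c : ℕ → ℝ → ℂ := fun k u => 1 / ((k : ℂ) + 1) - 2 / (sL u + 2 * (k : ℂ)) with hc
  set F : ℕ → ℝ → ℂ := fun k u => c k u * (Θ u * E u) with hF
  have hEn : ∀ u, ‖E u‖ = Real.exp x := fun u => by rw [hE]; exact norm_cexp_line_one u x
  have hEc : Continuous E := by rw [hE]; fun_prop
  have hΘc : Continuous Θ := continuous_limTheta_line θ (b := 1) (by norm_num)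
  have hΘE_int : Integrable (fun u => Θ u * E u) := integrable_limTheta_lineIntegrand hθ (b := 1) (by norm_num) x
  -- the exponent `ε`
  set ε : ℝ := min 1 ((θ - 1) / 2) with hε
  have hε0 : 0 < ε := lt_min one_pos (by linarith)
  have hε1 : ε ≤ 1 := min_le_left _ _
  have hεθ : 1 < θ - ε := by
    have : ε ≤ (θ - 1) / 2 := min_le_right _ _
    linarith
  -- continuity of the coefficients
  have hc_cont : ∀ k : ℕ, Continuous (c k) := by
    intro k
    rw [hc]
    refine continuous_const.sub (continuous_const.div ((by rw [hsL]; fun_prop : Continuous fun u => sL u + 2 * (k : ℂ)))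
      fun u => ?_)
    rw [hsL]; exact half_sub_line_add_ne_zero u k
  -- integrability of each term
  have hF_int : ∀ k : ℕ, Integrable (F k) := by
    intro k
    refine ((hΘE_int.norm.const_mul (1 / ((k : ℝ) + 1) * ((1 : ℝ) + 0) * 3)).mono'
      (((hc_cont k).mul (hΘc.mul hEc)).aestronglyMeasurable)) ?_ |>.congr ?_
    · refine Eventually.of_forall fun u => ?_
      simp only [Pi.mul_apply, norm_mul]
      have hcb : ‖c k u‖ ≤ 1 / ((k : ℝ) + 1) * (1 + 0) * 3 := by
        -- crude: ‖1/(k+1)‖ ≤ 1/(k+1)·1, ‖2/(s+2k)‖ ≤ 2/(2k+3/2) ≤ (4/3)/(1) ... use the ε = 1 bound? simpler direct: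
        rw [hc]
        have hk0 : (0 : ℝ) < (k : ℝ) + 1 := by positivity
        have h1 : ‖(1 : ℂ) / ((k : ℂ) + 1)‖ = 1 / ((k : ℝ) + 1) := by
          have : (k : ℂ) + 1 = (((k : ℝ) + 1 : ℝ) : ℂ) := by push_cast; ring
          rw [this, norm_div, norm_one, Complex.norm_real, Real.norm_eq_abs, abs_of_pos hk0]
        have hA : 0 < 2 * (k : ℝ) + 3 / 2 := by positivity
        have hden : 2 * (k : ℝ) + 3 / 2 ≤ ‖sL u + 2 * (k : ℂ)‖ := by
          have h1 := Complex.abs_re_le_norm (sL u + 2 * (k : ℂ))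
          have h2 : (sL u + 2 * (k : ℂ)).re = 2 * (k : ℝ) + 3 / 2 := by
            show ((1 : ℂ) / 2 - I * ((u : ℂ) + ((1 : ℝ) : ℂ) * I) + 2 * (k : ℂ)).re = 2 * (k : ℝ) + 3 / 2
            rw [add_re, half_sub_I_mul_line_one]; simp; ring
          rw [h2, abs_of_pos hA] at h1
          exact h1
        have h2 : ‖(2 : ℂ) / (sL u + 2 * (k : ℂ))‖ ≤ 2 / (2 * (k : ℝ) + 3 / 2) := by
          rw [norm_div, Complex.norm_two]
          exact div_le_div_of_nonneg_left (by norm_num) hA hden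
        have h3 : 2 / (2 * (k : ℝ) + 3 / 2) ≤ 2 / ((k : ℝ) + 1) := by
          apply div_le_div_of_nonneg_left (by norm_num) hk0; linarith
        calc ‖(1 : ℂ) / ((k : ℂ) + 1) - 2 / (sL u + 2 * (k : ℂ))‖
            ≤ ‖(1 : ℂ) / ((k : ℂ) + 1)‖ + ‖(2 : ℂ) / (sL u + 2 * (k : ℂ))‖ := norm_sub_le _ _
          _ ≤ 1 / ((k : ℝ) + 1) + 2 / ((k : ℝ) + 1) := by rw [h1]; linarith [h2.trans h3]
          _ = 1 / ((k : ℝ) + 1) * (1 + 0) * 3 := by ring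
      rw [← norm_mul]
      exact mul_le_mul_of_nonneg_right hcb (norm_nonneg _)
    · exact Eventually.of_forall fun u => rfl
  -- summability of the norms
  obtain ⟨C₁, hC₁0, hC₁⟩ := norm_limTheta_line_le (θ := θ) (by linarith) (b₀ := 1) (by norm_num)
  have hIint := integrable_one_add_abs_rpow_neg' hεθ
  set Iε : ℝ := ∫ u : ℝ, (1 + |u|) ^ (-(θ - ε)) with hIε
  have hIε0 : 0 ≤ Iε := integral_nonneg fun u => by positivity
  set a : ℕ → ℝ := fun k => 1 / ((k : ℝ) + 1) * (2 * (k : ℝ) + 3 / 2) ^ (-ε) with ha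
  have ha0 : ∀ k, 0 ≤ a k := fun k => by rw [ha]; positivity
  have hnormF : ∀ k : ℕ, ∀ u : ℝ, ‖F k u‖ ≤ C₁ * Real.exp x * a k * (1 + |u|) ^ (-(θ - ε)) := by
    intro k u
    have hy0 : 0 < 1 + |u| := by linarith [abs_nonneg u]
    have hA : 0 < 2 * (k : ℝ) + 3 / 2 := by positivity
    rw [hF]
    simp only [norm_mul, hEn]
    have h1 := norm_gaussCoeff_line_le u k hε0 hε1
    have h2 := hC₁ 1 le_rfl u
    have hsplit : ((1 + |u|) / (2 * (k : ℝ) + 3 / 2)) ^ ε = (1 + |u|) ^ ε * (2 * (k : ℝ) + 3 / 2) ^ (-ε) := by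
      rw [Real.div_rpow hy0.le hA.le, Real.rpow_neg hA.le, div_eq_mul_inv]
    have hcomb : (1 + |u|) ^ ε * (1 + |u|) ^ (-θ) = (1 + |u|) ^ (-(θ - ε)) := by
      rw [← Real.rpow_add hy0]; congr 1; ring
    calc ‖c k u‖ * (‖Θ u‖ * Real.exp x)
        ≤ (1 / ((k : ℝ) + 1) * ((1 + |u|) / (2 * (k : ℝ) + 3 / 2)) ^ ε) * ((C₁ * (1 + |u|) ^ (-θ)) * Real.exp x) := by
          gcongr
      _ = C₁ * Real.exp x * (1 / ((k : ℝ) + 1) * (2 * (k : ℝ) + 3 / 2) ^ (-ε)) *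
            ((1 + |u|) ^ ε * (1 + |u|) ^ (-θ)) := by rw [hsplit]; ring
      _ = C₁ * Real.exp x * a k * (1 + |u|) ^ (-(θ - ε)) := by rw [hcomb]
  have hint_le : ∀ k : ℕ, ∫ u : ℝ, ‖F k u‖ ≤ C₁ * Real.exp x * Iε * a k := by
    intro k
    calc ∫ u : ℝ, ‖F k u‖ ≤ ∫ u : ℝ, C₁ * Real.exp x * a k * (1 + |u|) ^ (-(θ - ε)) :=
          integral_mono (hF_int k).norm (hIint.const_mul _) (hnormF k)
      _ = C₁ * Real.exp x * a k * Iε := by rw [integral_const_mul]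
      _ = C₁ * Real.exp x * Iε * a k := by ring
  -- `a k ≤ (k+1)^{−(1+ε)}`, a summable sequence
  have ha_le : ∀ k : ℕ, a k ≤ ((k : ℝ) + 1) ^ (-(1 + ε)) := by
    intro k
    have hk0 : (0 : ℝ) < (k : ℝ) + 1 := by positivity
    have h1 : (2 * (k : ℝ) + 3 / 2) ^ (-ε) ≤ ((k : ℝ) + 1) ^ (-ε) :=
      Real.rpow_le_rpow_of_nonpos hk0 (by linarith) (by linarith)
    have h2 : ((k : ℝ) + 1) ^ (-(1 + ε)) = 1 / ((k : ℝ) + 1) * ((k : ℝ) + 1) ^ (-ε) := by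
      rw [show (-(1 + ε) : ℝ) = (-1) + (-ε) by ring, Real.rpow_add hk0, Real.rpow_neg_one, one_div]
    rw [h2, ha]
    exact mul_le_mul_of_nonneg_left h1 (by positivity)
  have hsum_pow : Summable fun k : ℕ => ((k : ℝ) + 1) ^ (-(1 + ε)) := by
    have h := (summable_nat_add_iff 1).2 (Real.summable_nat_rpow.2 (by linarith : (-(1 + ε) : ℝ) < -1))
    refine h.congr fun k => ?_
    push_cast
    rfl
  have hsum_a : Summable a := Summable.of_nonneg_of_le ha0 ha_le hsum_pow
  have hsum : Summable fun k : ℕ => ∫ u : ℝ, ‖F k u‖ :=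
    Summable.of_nonneg_of_le (fun k => integral_nonneg fun u => norm_nonneg _) hint_le (hsum_a.mul_left _)
  -- swap sum and integral
  have hswap := integral_tsum_of_summable_integral_norm hF_int hsum
  -- the integrand, pointwise, as `−γ Θ E + Σ' F k`
  have hψ_int := integrable_digamma_mul_limTheta_lineIntegrand hθ x
  have hpt : ∀ u : ℝ, digamma (sL u / 2) * Θ u * E u =
      -(Real.eulerMascheroniConstant : ℂ) * (Θ u * E u) + ∑' k : ℕ, F k u := by
    intro u
    have hG : digamma (sL u / 2) = -(Real.eulerMascheroniConstant : ℂ) + ∑' k : ℕ, c k u := by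
      rw [hsL, hc]; exact digamma_half_line_eq_tsum u
    rw [hG, hF]
    simp only
    rw [tsum_mul_right]
    ring
  have htsumF_int : Integrable (fun u : ℝ => ∑' k : ℕ, F k u) := by
    have h := hψ_int.add (hΘE_int.const_mul (Real.eulerMascheroniConstant : ℂ))
    refine h.congr (Eventually.of_forall fun u => ?_)
    have := hpt u
    simp only [Pi.add_apply] at *
    rw [hsL] at this
    simp only at this
    linear_combination this
  -- each `∫ F k` in terms of the two line transforms
  have hΘEk_int : ∀ k : ℕ, Integrable (fun u : ℝ => 2 / (sL u + 2 * (k : ℂ)) * (Θ u * E u)) := by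
    intro k
    have h := (hΘE_int.const_mul (1 / ((k : ℂ) + 1))).sub (hF_int k)
    refine h.congr (Eventually.of_forall fun u => ?_)
    rw [hF, hc]
    simp only [Pi.sub_apply]
    ring
  have hFk : ∀ k : ℕ, ∫ u : ℝ, F k u =
      1 / ((k : ℂ) + 1) * (∫ u : ℝ, Θ u * E u) - 2 * ∫ u : ℝ, Θ u / (sL u + 2 * (k : ℂ)) * E u := by
    intro k
    have e1 : (fun u : ℝ => F k u) = fun u : ℝ =>
        1 / ((k : ℂ) + 1) * (Θ u * E u) - 2 / (sL u + 2 * (k : ℂ)) * (Θ u * E u) := by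
      funext u; rw [hF, hc]; simp only; ring
    have h2k : (∫ u : ℝ, 2 / (sL u + 2 * (k : ℂ)) * (Θ u * E u)) = 2 * ∫ u : ℝ, Θ u / (sL u + 2 * (k : ℂ)) * E u := by
      rw [← integral_const_mul]
      refine integral_congr_ae (Eventually.of_forall fun u => ?_)
      have hne : sL u + 2 * (k : ℂ) ≠ 0 := by rw [hsL]; exact half_sub_line_add_ne_zero u k
      simp only
      field_simp
    rw [show (∫ u : ℝ, F k u) = ∫ u : ℝ, (fun u => F k u) u from rfl, e1,
      integral_sub (hΘE_int.const_mul _) (hΘEk_int k), integral_const_mul, h2k]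
  -- assemble
  unfold invFourierLine
  have hL : (fun u : ℝ => digamma ((1 / 2 - I * ((u : ℂ) + ((1 : ℝ) : ℂ) * I)) / 2) *
      limTheta θ ((u : ℂ) + ((1 : ℝ) : ℂ) * I) * Complex.exp (-I * ((u : ℂ) + ((1 : ℝ) : ℂ) * I) * (x : ℂ))) =
      fun u : ℝ => -(Real.eulerMascheroniConstant : ℂ) * (Θ u * E u) + ∑' k : ℕ, F k u := by
    funext u; rw [← hpt u]
  rw [hL, integral_add (hΘE_int.const_mul _) htsumF_int, integral_const_mul, ← hswap]
  simp_rw [hFk]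
  rw [mul_add, ← tsum_mul_left]
  congr 1
  · simp only [hΘ, hE]; ring
  · refine tsum_congr fun k => ?_
    simp only [hΘ, hE, hsL]
    ring

end Summit.RiemannHypothesis.RiemannHypothesis.Theorems.SuzukiKernelSemigroup

end
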